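import Summits.AtomisticToContinuum.Crystallization.Theorems.HolmgrenBoyleLindLineVanishing

/-!
# Route `HolmgrenBoyleLind`: Lennard-Jones force fields of separated sources, part 3 —
a separated signed source visible on no open set is empty

Support file for item stmt-AtomisticToContinuum-6079 (`FLCEquilibriumPeriodic` ⇔ crux
`HalfSpaceUniqueContinuation`, `flcEquilibriumPeriodic_iff_uc`), continuing
`HolmgrenBoyleLindLineVanishing.lean`; part 4 (`HolmgrenBoyleLindUCContinuum.lean`) draws the
consequences for the crux (the provable half `UCContinuum` of the planner's two-layer split
`UC ⇐ UCContinuum → UCDiscrete`).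

* `hbl_countable_of_separated`, `hbl_exists_clean_segment` — a separated set is countable, so from
  any base point `x₀` off the source the closed segment `[x₀, x]` misses the source for points `x`
  arbitrarily close to any prescribed point (the bad `x` lie on countably many lines, a null set:
  `Measure.addHaar_affineSubspace`);
* `hbl_field_ne_zero_near_source` — near a point `y₀` of `X⁺` (disjoint from `X⁻`) the signed field
  `Φ = Σ'_{X⁺} − Σ'_{X⁻}` does not vanish (the `‖v‖⁻¹³` core `inv_norm_le_norm_kernel` against the
  uniformly bounded rest, `hbl_exists_tsum_norm_ljForce_le_of_clear`);
* `hbl_sources_empty_of_field_eqOn_open` — **two disjoint `δ`-separated sources whose signed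
  Lennard-Jones force field vanishes on a non-empty open set are empty**
  (`hbl_field_eq_zero_of_clean_segment` + the two facts above).

All `[folklore]`; nothing here closes an item.
-/

noncomputable section

namespace Summit.AtomisticToContinuum.Crystallization.Theorems

open scoped BigOperators Topology InnerProductSpace
open Filter Set
open Literature.MathematicalPhysics.StatisticalMechanics
open Summit.AtomisticToContinuum.Crystallization.Theorems.ExcessDecayLiouville
open Summit.AtomisticToContinuum.Crystallization.Theorems.HolmgrenBoyleLind

/-! ## Clean segments are generic -/

/-- A `δ`-separated subset of `ℝ³` is countable (finitely many points in every ball,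
`hbl_finite_near`). [folklore] -/
theorem hbl_countable_of_separated {X : Set (EuclideanSpace ℝ (Fin 3))} {δ : ℝ} (hδ : 0 < δ)
    (hsep : ∀ a ∈ X, ∀ b ∈ X, a ≠ b → δ ≤ dist a b) : X.Countable := by
  have hX : X = ⋃ n : ℕ, {q : EuclideanSpace ℝ (Fin 3) | q ∈ X ∧ dist q 0 ≤ n} := by
    ext q
    simp only [Set.mem_iUnion, Set.mem_setOf_eq]
    constructor
    · intro hq
      obtain ⟨n, hn⟩ := exists_nat_ge (dist q 0)
      exact ⟨n, hq, hn⟩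
    · rintro ⟨n, hq, -⟩
      exact hq
  rw [hX]
  exact Set.countable_iUnion fun n => (hbl_finite_near hδ hsep 0 n).countable

/-- **Clean segments are generic.** If `X ⊂ ℝ³` is countable and `x₀ ∉ X`, then within any distance
`ε > 0` of any point `y₀` there is `x` such that the closed segment `[x₀, x]` misses `X`: the bad
points lie on the countably many lines through `x₀` and a point of `X`, a Lebesgue-null set, while
the ball `B(y₀, ε)` has positive measure. [folklore] -/
theorem hbl_exists_clean_segment {X : Set (EuclideanSpace ℝ (Fin 3))} (hX : X.Countable)
    {x₀ : EuclideanSpace ℝ (Fin 3)} (hx₀ : x₀ ∉ X) (y₀ : EuclideanSpace ℝ (Fin 3)) {ε : ℝ}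
    (hε : 0 < ε) :
    ∃ x : EuclideanSpace ℝ (Fin 3), dist x y₀ < ε ∧
      ∀ σ : ℝ, 0 ≤ σ → σ ≤ 1 → x₀ + σ • (x - x₀) ∉ X := by
  set Bad : Set (EuclideanSpace ℝ (Fin 3)) := ⋃ y ∈ X,
    ((AffineSubspace.mk' x₀ (ℝ ∙ (y - x₀)) : AffineSubspace ℝ (EuclideanSpace ℝ (Fin 3))) :
      Set (EuclideanSpace ℝ (Fin 3))) with hBad
  have hnull : MeasureTheory.volume Bad = 0 := by
    rw [hBad, MeasureTheory.measure_biUnion_null_iff hX]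
    intro y _
    apply MeasureTheory.Measure.addHaar_affineSubspace
    intro htop
    have hdir : (ℝ ∙ (y - x₀)) = (⊤ : Submodule ℝ (EuclideanSpace ℝ (Fin 3))) := by
      have h := congrArg AffineSubspace.direction htop
      rwa [AffineSubspace.direction_mk', AffineSubspace.direction_top] at h
    have hle : Module.finrank ℝ (ℝ ∙ (y - x₀)) ≤ 1 := by
      have h := finrank_span_le_card (R := ℝ) ({y - x₀} : Set (EuclideanSpace ℝ (Fin 3)))
      simpa using h
    rw [hdir, finrank_top, finrank_euclideanSpace_fin] at hle
    omega
  have hball : 0 < MeasureTheory.volume (Metric.ball y₀ ε) :=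
    Metric.measure_ball_pos MeasureTheory.volume y₀ hε
  have hnot : ¬ Metric.ball y₀ ε ⊆ Bad := fun hsub =>
    (lt_irrefl (0 : ENNReal)) (hball.trans_le ((MeasureTheory.measure_mono hsub).trans hnull.le))
  obtain ⟨x, hxball, hxBad⟩ := Set.not_subset.1 hnot
  refine ⟨x, Metric.mem_ball.1 hxball, fun σ _ _ hmem => hxBad ?_⟩
  rw [hBad, Set.mem_iUnion₂]
  refine ⟨x₀ + σ • (x - x₀), hmem, ?_⟩
  have hσ : σ ≠ 0 := by
    rintro rfl
    apply hx₀
    simpa using hmem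
  rw [SetLike.mem_coe, AffineSubspace.mem_mk', vsub_eq_sub, Submodule.mem_span_singleton]
  refine ⟨σ⁻¹, ?_⟩
  rw [add_sub_cancel_left, smul_smul, inv_mul_cancel₀ hσ, one_smul]

/-! ## Blow-up at a source point -/

/-- **Blow-up at a source point.** Let `X⁺, X⁻ ⊂ ℝ³` be `δ`-separated and disjoint and
`y₀ ∈ X⁺`. Then the signed force field `Φ = Σ'_{X⁺} (V′/d)(· − y) − Σ'_{X⁻} (V′/d)(· − y)` does
not vanish at the points `x ≠ y₀` close to `y₀`: the term of `y₀` has norm `≥ ‖x − y₀‖⁻¹`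
(`inv_norm_le_norm_kernel`) while the rest is bounded uniformly
(`hbl_exists_tsum_norm_ljForce_le_of_clear`). [folklore] -/
theorem hbl_field_ne_zero_near_source {Xp Xm : Set (EuclideanSpace ℝ (Fin 3))} {δ : ℝ}
    (hδ : 0 < δ)
    (hsepp : ∀ a ∈ Xp, ∀ b ∈ Xp, a ≠ b → δ ≤ dist a b)
    (hsepm : ∀ a ∈ Xm, ∀ b ∈ Xm, a ≠ b → δ ≤ dist a b)
    (hdisj : ∀ y ∈ Xp, y ∉ Xm) {y₀ : EuclideanSpace ℝ (Fin 3)} (hy₀ : y₀ ∈ Xp) :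
    ∃ ε : ℝ, 0 < ε ∧ ∀ x : EuclideanSpace ℝ (Fin 3), dist x y₀ < ε → x ≠ y₀ →
      (∑' y : Xp, (deriv lennardJones (dist x y) / dist x y) • (x - (y : (EuclideanSpace ℝ (Fin 3))))) -
        (∑' y : Xm, (deriv lennardJones (dist x y) / dist x y) •
          (x - (y : (EuclideanSpace ℝ (Fin 3))))) ≠ 0 := by
  classical
  -- clearance of `y₀` from `X⁻`
  have hXmc : IsClosed Xm := Metric.isClosed_of_pairwise_le_dist hδ hsepm
  obtain ⟨ρm, hρm, hballm⟩ := Metric.isOpen_iff.1 hXmc.isOpen_compl y₀ (hdisj y₀ hy₀)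
  set ρ : ℝ := min (δ / 2) (ρm / 2) with hρ
  have hρ0 : 0 < ρ := lt_min (half_pos hδ) (half_pos hρm)
  obtain ⟨M, hM0, hM⟩ := hbl_exists_tsum_norm_ljForce_le_of_clear hδ hρ0
  set ε : ℝ := min ρ (min (1 / 2) (1 / (2 * M + 1))) with hε
  have hε0 : 0 < ε := lt_min hρ0 (lt_min (by norm_num) (by positivity))
  refine ⟨ε, hε0, ?_⟩
  intro x hx hxy hΦ
  have hxρ : dist x y₀ < ρ := hx.trans_le (min_le_left _ _)
  have hxδ : dist x y₀ < δ / 2 := hxρ.trans_le (min_le_left _ _)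
  have hxρm : dist x y₀ < ρm / 2 := hxρ.trans_le (min_le_right _ _)
  have hxhalf : dist x y₀ < 1 / 2 := hx.trans_le ((min_le_right _ _).trans (min_le_left _ _))
  have hxM : dist x y₀ < 1 / (2 * M + 1) := hx.trans_le ((min_le_right _ _).trans (min_le_right _ _))
  set F : (EuclideanSpace ℝ (Fin 3)) → (EuclideanSpace ℝ (Fin 3)) := fun y =>
    (deriv lennardJones (dist x y) / dist x y) • (x - y) with hF
  -- the full `X⁺`-family is summable (clearance `min (dist y₀ x) ρ` from `x`)
  have hdpos : 0 < dist y₀ x := dist_pos.2 (Ne.symm hxy)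
  have hclP : ∀ y : Xp, min (dist y₀ x) ρ ≤ dist (y : EuclideanSpace ℝ (Fin 3)) x := by
    intro y
    by_cases hyy : (y : EuclideanSpace ℝ (Fin 3)) = y₀
    · rw [hyy]
      exact min_le_left _ _
    · refine (min_le_right _ _).trans ?_
      have h1 : δ ≤ dist (y : EuclideanSpace ℝ (Fin 3)) y₀ := hsepp _ y.2 _ hy₀ hyy
      have h2 : dist (y : EuclideanSpace ℝ (Fin 3)) y₀ ≤ dist (y : EuclideanSpace ℝ (Fin 3)) x + dist x y₀ :=
        dist_triangle _ _ _
      have h3 : ρ ≤ δ / 2 := min_le_left _ _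
      linarith
  have hsumP : Summable (fun y : Xp => F y) :=
    (hbl_summable_norm_ljForce_of_clear hδ (lt_min hdpos hρ0) hsepp (fun y : Xp => (y : EuclideanSpace ℝ (Fin 3)))
      Subtype.val_injective (fun y => y.2) hclP).of_norm
  -- split off the term of `y₀`
  set N : Finset Xp := {⟨y₀, hy₀⟩} with hN
  have hsplit := hsumP.sum_add_tsum_subtype_compl N
  rw [hN, Finset.sum_singleton] at hsplit
  -- the rest over `X⁺` is bounded by `M`
  have hclR : ∀ y : {y : Xp // y ∉ N}, ρ ≤ dist ((y : Xp) : EuclideanSpace ℝ (Fin 3)) x := by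
    intro y
    have hyy : ((y : Xp) : EuclideanSpace ℝ (Fin 3)) ≠ y₀ := by
      intro h
      apply y.2
      have heq : (y : Xp) = ⟨y₀, hy₀⟩ := Subtype.ext h
      rw [heq, hN]
      exact Finset.mem_singleton_self _
    have h1 : δ ≤ dist ((y : Xp) : EuclideanSpace ℝ (Fin 3)) y₀ := hsepp _ (y : Xp).2 _ hy₀ hyy
    have h2 : dist ((y : Xp) : EuclideanSpace ℝ (Fin 3)) y₀ ≤
        dist ((y : Xp) : EuclideanSpace ℝ (Fin 3)) x + dist x y₀ := dist_triangle _ _ _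
    have h3 : ρ ≤ δ / 2 := min_le_left _ _
    linarith
  have hinjR : Function.Injective (fun y : {y : Xp // y ∉ N} => ((y : Xp) : EuclideanSpace ℝ (Fin 3))) :=
    fun a b h => Subtype.ext (Subtype.ext h)
  have hRle : ‖∑' y : {y : Xp // y ∉ N}, F y‖ ≤ M :=
    (norm_tsum_le_tsum_norm (hbl_summable_norm_ljForce_of_clear hδ hρ0 hsepp _ hinjR
      (fun y => (y : Xp).2) hclR)).trans (hM hsepp _ hinjR (fun y => (y : Xp).2) x hclR)
  -- the `X⁻`-family is bounded by `M`
  have hclM : ∀ y : Xm, ρ ≤ dist (y : EuclideanSpace ℝ (Fin 3)) x := by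
    intro y
    have hy : (y : EuclideanSpace ℝ (Fin 3)) ∉ Metric.ball y₀ ρm := fun h => hballm h y.2
    rw [Metric.mem_ball, not_lt] at hy
    have h2 : dist (y : EuclideanSpace ℝ (Fin 3)) y₀ ≤ dist (y : EuclideanSpace ℝ (Fin 3)) x + dist x y₀ :=
      dist_triangle _ _ _
    have h3 : ρ ≤ ρm / 2 := min_le_right _ _
    linarith
  have hMle : ‖∑' y : Xm, F y‖ ≤ M :=
    (norm_tsum_le_tsum_norm (hbl_summable_norm_ljForce_of_clear hδ hρ0 hsepm _ Subtype.val_injective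
      (fun y => y.2) hclM)).trans (hM hsepm _ Subtype.val_injective (fun y => y.2) x hclM)
  -- the term of `y₀` is large
  have hcore : (dist x y₀)⁻¹ ≤ ‖F y₀‖ := by
    have hne : y₀ ≠ x := Ne.symm hxy
    simp only [hF]
    rw [ljForce_eq_kernel hne, ← dist_eq_norm]
    have h := inv_norm_le_norm_kernel (sub_ne_zero.2 hxy) (by rw [← dist_eq_norm]; exact hxhalf.le)
    rwa [← dist_eq_norm] at h
  have hbig : 2 * M + 1 < (dist x y₀)⁻¹ := by
    rw [lt_inv_comm₀ (by positivity) (dist_pos.2 hxy)]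
    rwa [one_div] at hxM
  -- but by `Φ(x) = 0` it equals `Σ'_{X⁻} − rest`
  have heq : F y₀ = (∑' y : Xm, F y) - ∑' y : {y : Xp // y ∉ N}, F y := by
    have h0 : (∑' y : Xp, F y) - (∑' y : Xm, F y) = 0 := hΦ
    rw [← hsplit] at h0
    -- F y₀ + R - Sm = 0
    have := sub_eq_zero.1 h0
    rw [← this]
    abel
  have hsmall : ‖F y₀‖ ≤ 2 * M := by
    rw [heq]
    refine (norm_sub_le _ _).trans ?_
    linarith
  linarith

/-! ## Sources visible on no open set are empty -/

/-- One-sided form of `hbl_sources_empty_of_field_eqOn_open`: the positive source is empty.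
[folklore] -/
theorem hbl_posSource_empty_of_field_eqOn_open {Xp Xm : Set (EuclideanSpace ℝ (Fin 3))} {δ : ℝ}
    (hδ : 0 < δ)
    (hsepp : ∀ a ∈ Xp, ∀ b ∈ Xp, a ≠ b → δ ≤ dist a b)
    (hsepm : ∀ a ∈ Xm, ∀ b ∈ Xm, a ≠ b → δ ≤ dist a b)
    (hdisj : ∀ y ∈ Xp, y ∉ Xm) {U₀ : Set (EuclideanSpace ℝ (Fin 3))} (hU₀ : IsOpen U₀)
    (hne : U₀.Nonempty) (hUX : ∀ z ∈ U₀, z ∉ Xp ∪ Xm)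
    (hΦ : ∀ z ∈ U₀,
      (∑' y : Xp, (deriv lennardJones (dist z y) / dist z y) • (z - (y : (EuclideanSpace ℝ (Fin 3))))) -
        (∑' y : Xm, (deriv lennardJones (dist z y) / dist z y) • (z - (y : (EuclideanSpace ℝ (Fin 3))))) = 0) :
    Xp = ∅ := by
  rw [Set.eq_empty_iff_forall_notMem]
  intro y₀ hy₀
  obtain ⟨x₀, hx₀⟩ := hne
  obtain ⟨ε, hε, hblow⟩ := hbl_field_ne_zero_near_source hδ hsepp hsepm hdisj hy₀
  have hcount : (Xp ∪ Xm).Countable :=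
    (hbl_countable_of_separated hδ hsepp).union (hbl_countable_of_separated hδ hsepm)
  obtain ⟨x, hxε, hseg⟩ := hbl_exists_clean_segment hcount (hUX x₀ hx₀) y₀ hε
  have hxy : x ≠ y₀ := by
    intro h
    have h1 := hseg 1 zero_le_one le_rfl
    rw [one_smul, add_sub_cancel, h] at h1
    exact h1 (Or.inl hy₀)
  exact hblow x hxε hxy (hbl_field_eq_zero_of_clean_segment hδ hsepp hsepm hU₀ hΦ hx₀ hseg)

/-- **A separated signed Lennard-Jones source visible on no open set is empty.** Let
`X⁺, X⁻ ⊂ ℝ³` be `δ`-separated and disjoint, and suppose the signed force field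
`Φ(z) = Σ'_{y ∈ X⁺} (V′(|z−y|)/|z−y|)(z − y) − Σ'_{y ∈ X⁻} (V′(|z−y|)/|z−y|)(z − y)`
(`V = r⁻¹²/12 − r⁻⁶/6`) vanishes on a non-empty open set `U₀` off `X⁺ ∪ X⁻`. Then
`X⁺ = X⁻ = ∅`. («A rearrangement cannot hide from an open set»: one-variable identity theorem
along generic segments + the `r⁻¹³` core.) [folklore] -/
theorem hbl_sources_empty_of_field_eqOn_open {Xp Xm : Set (EuclideanSpace ℝ (Fin 3))} {δ : ℝ}
    (hδ : 0 < δ)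
    (hsepp : ∀ a ∈ Xp, ∀ b ∈ Xp, a ≠ b → δ ≤ dist a b)
    (hsepm : ∀ a ∈ Xm, ∀ b ∈ Xm, a ≠ b → δ ≤ dist a b)
    (hdisj : Disjoint Xp Xm) {U₀ : Set (EuclideanSpace ℝ (Fin 3))} (hU₀ : IsOpen U₀)
    (hne : U₀.Nonempty) (hUX : ∀ z ∈ U₀, z ∉ Xp ∪ Xm)
    (hΦ : ∀ z ∈ U₀,
      (∑' y : Xp, (deriv lennardJones (dist z y) / dist z y) • (z - (y : (EuclideanSpace ℝ (Fin 3))))) -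
        (∑' y : Xm, (deriv lennardJones (dist z y) / dist z y) • (z - (y : (EuclideanSpace ℝ (Fin 3))))) = 0) :
    Xp = ∅ ∧ Xm = ∅ := by
  refine ⟨hbl_posSource_empty_of_field_eqOn_open hδ hsepp hsepm
      (fun y hy hy' => Set.disjoint_left.1 hdisj hy hy') hU₀ hne hUX hΦ,
    hbl_posSource_empty_of_field_eqOn_open hδ hsepm hsepp
      (fun y hy hy' => Set.disjoint_right.1 hdisj hy hy') hU₀ hne
      (fun z hz h => hUX z hz (Set.union_comm Xm Xp ▸ h)) fun z hz => ?_⟩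
  rw [← neg_sub, hΦ z hz, neg_zero]

end Summit.AtomisticToContinuum.Crystallization.Theorems

end
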